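import Literature.NumberTheory.Sieve.QuadraticRootsLevelAxisParam
import Mathlib.MeasureTheory.Integral.IntervalIntegral.Basic
import HarnessLib

/-!
# Cycle integrals along the axis of an indefinite form (`Δ > 0`)

Topic `Literature/NumberTheory/Sieve`, continuation of `QuadraticRootsLevelAxisParam.lean`
(Tóth's positive-discriminant case).  With the parametrisation `t ↦ P_Q(t)` of the geodesic `S_Q`
(`A > 0`, `Δ > 0`), on which the automorph `U` of a Pell solution acts by `t ↦ ε'² t`
(`ε' = x − y√Δ`), the integral of a function `f` on `ℍ` along `k` periods of the closed geodesic
is the **cycle integral** `∫_{ε'^{2k}}^{1} f(P_Q(t)) dt/t` (`dt/t` is the hyperbolic arc length in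
the Cayley coordinate).  This file proves the bookkeeping every closed-geodesic argument uses:

* `axisPt₀` (the parametrisation extended by a junk value to all `t`), `continuousOn_axisPt₀`;
* `integral_period_shift` — `∫_{c^{j+1}}^{c^j} f(P(t)) dt/t = ∫_c^1 f(P(c^j t)) dt/t`
  (`intervalIntegral.integral_comp_mul_left`);
* `apply_axisPt₀_mul_of_invariant` — if `f(U • z) = f(z)` on `S_Q` then `f(P(ε'^{2j} t)) = f(P(t))`;
* **`cycleIntegral_eq_mul`** — for such `f`, continuous along the axis, the integral over `k`
  periods is `k` times the integral over one period.

## References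

* Á. Tóth, *Roots of quadratic congruences*, IMRN 2000, no. 14, 719–739 (sums over closed
  geodesics; cite-only in the store, cf. [cite: Ngo2024, §1]). [cite: Toth2000, main theorem]
* W. Duke, J. B. Friedlander, H. Iwaniec, Ann. of Math. (2) 141 (1995), §2 (the model construction
  for `Δ < 0`, where the cycle integral degenerates to evaluation at the Heegner point).
  [cite: DukeFriedlanderIwaniec1995, §2 p. 427]
-/

noncomputable section

namespace Literature.NumberTheory.Sieve

open scoped MatrixGroups UpperHalfPlane
open Literature.NumberTheory.QuadraticFields.Quadratic (BinQF)
open UpperHalfPlane MeasureTheory intervalIntegral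

namespace RootForms

variable {Q : BinQF}

/-! ### The parametrisation as a total function -/

/-- The parametrisation `P_Q(t)` extended to all real `t` (junk value `P_Q(1)` for `t ≤ 0`).
[folklore] -/
def axisPt₀ (Q : BinQF) (hA : 0 < Q.a) (hΔ : 0 < Q.disc) (t : ℝ) : ℍ :=
  if ht : 0 < t then axisPt Q hA hΔ t ht else axisPt Q hA hΔ 1 one_pos

/-- On `t > 0`, `axisPt₀` is `axisPt`. [folklore] -/
theorem axisPt₀_of_pos (hA : 0 < Q.a) (hΔ : 0 < Q.disc) {t : ℝ} (ht : 0 < t) :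
    axisPt₀ Q hA hΔ t = axisPt Q hA hΔ t ht := dif_pos ht

/-- On `t > 0`, the underlying complex number of `axisPt₀ t` is `axisPtC t`. [folklore] -/
theorem coe_axisPt₀_of_pos (hA : 0 < Q.a) (hΔ : 0 < Q.disc) {t : ℝ} (ht : 0 < t) :
    ((axisPt₀ Q hA hΔ t : ℍ) : ℂ) = axisPtC Q t := by
  rw [axisPt₀_of_pos hA hΔ ht]; rfl

/-- `t ↦ axisPtC Q t` is continuous. [folklore] -/
theorem continuous_axisPtC (Q : BinQF) : Continuous (axisPtC Q) := by
  unfold axisPtC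
  have h1 : Continuous fun t : ℝ => (1 + t ^ 2 : ℝ) := by continuity
  have h0 : ∀ t : ℝ, (1 + t ^ 2 : ℝ) ≠ 0 := fun t => by positivity
  refine Continuous.add ?_ (Continuous.mul ?_ continuous_const)
  · exact Complex.continuous_ofReal.comp ((by continuity : Continuous fun t : ℝ =>
      rootPlus Q + t ^ 2 * rootMinus Q).div h1 h0)
  · exact Complex.continuous_ofReal.comp ((by continuity : Continuous fun t : ℝ =>
      t * (rootPlus Q - rootMinus Q)).div h1 h0)

/-- **`t ↦ P_Q(t)` is continuous on `t > 0`** (as a map into `ℍ`). [folklore] -/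
theorem continuousOn_axisPt₀ (hA : 0 < Q.a) (hΔ : 0 < Q.disc) :
    ContinuousOn (axisPt₀ Q hA hΔ) (Set.Ioi 0) := by
  rw [UpperHalfPlane.isEmbedding_coe.continuousOn_iff]
  refine ((continuous_axisPtC Q).continuousOn).congr fun t ht => ?_
  exact coe_axisPt₀_of_pos hA hΔ ht

/-! ### Cycle integrals -/

/-- The **cycle integral over `k` periods**: `∫_{ε'^{2k}}^{1} f(P_Q(t)) dt/t`, `ε' = x − y√Δ` the
conjugate unit of the Pell solution `a = (x, y)` (for `0 < ε' < 1` this runs over `k` fundamental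
arcs of the deck transformation `U(a)` on `S_Q`). [cite: Toth2000, main theorem (sums over closed geodesics; cf. Ngo2024 §1)] -/
def cycleIntegral (Q : BinQF) (hA : 0 < Q.a) (hΔ : 0 < Q.disc) (a : Pell.Solution₁ Q.disc) (k : ℕ)
    (f : ℍ → ℂ) : ℂ :=
  ∫ t in (pellUnitInv Q a ^ (2 * k))..1, f (axisPt₀ Q hA hΔ t) / t

/-- Points of `[[x, y]]` are positive when `x, y > 0`. [folklore] -/
theorem pos_of_mem_uIcc {x y t : ℝ} (hx : 0 < x) (hy : 0 < y) (h : t ∈ Set.uIcc x y) : 0 < t := by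
  rcases Set.mem_uIcc.1 h with ⟨h1, -⟩ | ⟨h1, -⟩
  · exact hx.trans_le h1
  · exact hy.trans_le h1

/-- **Period shift** (change of variables `t ↦ c^j t` in `dt/t`): for `c ≠ 0`,
`∫_{c^{j+1}}^{c^j} f(P(t)) dt/t = ∫_{c}^{1} f(P(c^j t)) dt/t`. [folklore] -/
theorem integral_period_shift (hA : 0 < Q.a) (hΔ : 0 < Q.disc) (f : ℍ → ℂ) {c : ℝ} (hc : c ≠ 0)
    (j : ℕ) :
    ∫ t in (c ^ (j + 1))..(c ^ j), f (axisPt₀ Q hA hΔ t) / t =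
      ∫ t in c..1, f (axisPt₀ Q hA hΔ (c ^ j * t)) / t := by
  have hcj : (c ^ j : ℝ) ≠ 0 := pow_ne_zero _ hc
  have key := intervalIntegral.integral_comp_mul_left
    (fun x : ℝ => f (axisPt₀ Q hA hΔ x) / x) (a := c) (b := 1) hcj
  rw [mul_one, show c ^ j * c = c ^ (j + 1) by ring] at key
  have key2 : ∫ x in (c ^ (j + 1))..(c ^ j), f (axisPt₀ Q hA hΔ x) / x =
      (c ^ j : ℝ) • ∫ t in c..1, f (axisPt₀ Q hA hΔ (c ^ j * t)) / (((c ^ j * t : ℝ)) : ℂ) := by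
    rw [key, smul_smul, mul_inv_cancel₀ hcj, one_smul]
  rw [key2, ← intervalIntegral.integral_smul]
  refine intervalIntegral.integral_congr fun t _ => ?_
  simp only [Complex.real_smul]
  push_cast
  rcases eq_or_ne t 0 with rfl | ht
  · simp
  · have hcjC : ((c : ℂ) ^ j) ≠ 0 := by exact_mod_cast hcj
    have htC : (t : ℂ) ≠ 0 := by exact_mod_cast ht
    field_simp

/-! ### Invariance under the deck transformation -/

/-- If `f(U • z) = f(z)` on `S_Q` for a stabiliser element `U`, then `f(U^j • z) = f(z)` on `S_Q`.
[folklore] -/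
theorem apply_pow_smul_of_invariant {f : ℍ → ℂ} {U : SL(2, ℤ)} (hU : U ∈ stab Q)
    (hf : ∀ z ∈ geod Q, f (U • z) = f z) (j : ℕ) {z : ℍ} (hz : z ∈ geod Q) :
    f (U ^ j • z) = f z := by
  induction j with
  | zero => simp
  | succ j ih =>
    rw [pow_succ', mul_smul, hf _ (smul_mem_geod_of_mem_stab (Subgroup.pow_mem _ hU j) hz), ih]

/-- `axisPt` only depends on the parameter (proof-irrelevance helper). [folklore] -/
theorem axisPt_congr (hA : 0 < Q.a) (hΔ : 0 < Q.disc) {t t' : ℝ} (ht : 0 < t) (ht' : 0 < t')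
    (h : t = t') : axisPt Q hA hΔ t ht = axisPt Q hA hΔ t' ht' := by
  subst h; rfl

/-- `ε'^{2j} t > 0` for `t > 0`. [folklore] -/
theorem pellUnitInv_pow_mul_pos (hΔ : 0 ≤ Q.disc) (a : Pell.Solution₁ Q.disc) (j : ℕ) {t : ℝ}
    (ht : 0 < t) : 0 < pellUnitInv Q a ^ (2 * j) * t := by
  rw [pow_mul]
  exact mul_pos (pow_pos (sq_pos_iff.2 (pellUnitInv_ne_zero hΔ a)) j) ht

/-- **Invariance along the axis**: if `f(U(a) • z) = f(z)` on `S_Q` then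
`f(P_Q(ε'^{2j} t)) = f(P_Q(t))` for `t > 0` (`U(a)^j • P_Q(t) = P_Q(ε'^{2j} t)`).
[cite: Toth2000, main theorem (closed geodesics; cf. Ngo2024 §1)] -/
theorem apply_axisPt₀_mul_of_invariant (hA : 0 < Q.a) (hΔ : 0 < Q.disc) (a : Pell.Solution₁ Q.disc)
    {f : ℍ → ℂ} (hf : ∀ z ∈ geod Q, f (automorph Q a • z) = f z) (j : ℕ) {t : ℝ} (ht : 0 < t) :
    f (axisPt₀ Q hA hΔ (pellUnitInv Q a ^ (2 * j) * t)) = f (axisPt₀ Q hA hΔ t) := by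
  have hpos := pellUnitInv_pow_mul_pos hΔ.le a j ht
  rw [axisPt₀_of_pos hA hΔ hpos, axisPt₀_of_pos hA hΔ ht]
  have key := automorph_pow_smul_axisPt hA hΔ a j ht
  have e : axisPt Q hA hΔ (pellUnitInv Q (a ^ j) ^ 2 * t) (pellUnitInv_sq_mul_pos hΔ.le (a ^ j) ht) =
      axisPt Q hA hΔ (pellUnitInv Q a ^ (2 * j) * t) hpos :=
    axisPt_congr hA hΔ _ _ (by rw [pellUnitInv_pow_sq hΔ.le])
  rw [← e, ← key]
  exact apply_pow_smul_of_invariant (automorph_mem_stab Q a) hf j (axisPt_mem_geod hA hΔ ht)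

/-! ### `k` periods = `k` times one period -/

/-- The integrand `f(P(t))/t` is interval-integrable between positive endpoints when `f ∘ P` is
continuous on `t > 0`. [folklore] -/
theorem intervalIntegrable_axis (hA : 0 < Q.a) (hΔ : 0 < Q.disc) {f : ℍ → ℂ}
    (hcont : ContinuousOn (fun t : ℝ => f (axisPt₀ Q hA hΔ t)) (Set.Ioi 0)) {x y : ℝ}
    (hx : 0 < x) (hy : 0 < y) :
    IntervalIntegrable (fun t : ℝ => f (axisPt₀ Q hA hΔ t) / t) volume x y := by
  refine ContinuousOn.intervalIntegrable ?_
  have hsub : Set.uIcc x y ⊆ Set.Ioi 0 := fun t ht => pos_of_mem_uIcc hx hy ht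
  refine ContinuousOn.div (hcont.mono hsub) (Complex.continuous_ofReal.continuousOn) ?_
  intro t ht
  exact_mod_cast (pos_of_mem_uIcc hx hy ht).ne'

/-- **Cycle integral over `k` periods = `k ×` one period**, for `f` invariant under the deck
transformation `U(a)` on `S_Q` and continuous along the axis.
[cite: Toth2000, main theorem (sums over closed geodesics; cf. Ngo2024 §1)] -/
theorem cycleIntegral_eq_mul (hA : 0 < Q.a) (hΔ : 0 < Q.disc) (a : Pell.Solution₁ Q.disc)
    {f : ℍ → ℂ} (hf : ∀ z ∈ geod Q, f (automorph Q a • z) = f z)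
    (hcont : ContinuousOn (fun t : ℝ => f (axisPt₀ Q hA hΔ t)) (Set.Ioi 0)) (k : ℕ) :
    cycleIntegral Q hA hΔ a k f = k * cycleIntegral Q hA hΔ a 1 f := by
  set c : ℝ := pellUnitInv Q a ^ 2 with hc
  have hc0 : 0 < c := sq_pos_iff.2 (pellUnitInv_ne_zero hΔ.le a)
  have hck : ∀ j : ℕ, pellUnitInv Q a ^ (2 * j) = c ^ j := fun j => by rw [hc, pow_mul]
  unfold cycleIntegral
  rw [hck k, hck 1, pow_one]
  -- split `∫_{c^k}^{1} = ∑_{j<k} ∫_{c^{j+1}}^{c^j}`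
  have hsplit : ∫ t in (c ^ k)..1, f (axisPt₀ Q hA hΔ t) / t =
      ∑ j ∈ Finset.range k, ∫ t in (c ^ (j + 1))..(c ^ j), f (axisPt₀ Q hA hΔ t) / t := by
    have h := intervalIntegral.sum_integral_adjacent_intervals (f := fun t : ℝ => f (axisPt₀ Q hA hΔ t) / t)
      (μ := volume) (a := fun j => c ^ j) (n := k) (fun j _ =>
        intervalIntegrable_axis hA hΔ hcont (pow_pos hc0 j) (pow_pos hc0 (j + 1)))
    simp only [pow_zero] at h
    rw [intervalIntegral.integral_symm, ← h, ← Finset.sum_neg_distrib]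
    refine Finset.sum_congr rfl fun j _ => ?_
    rw [intervalIntegral.integral_symm, neg_neg]
  rw [hsplit]
  -- each period contributes the same
  have hterm : ∀ j : ℕ, ∫ t in (c ^ (j + 1))..(c ^ j), f (axisPt₀ Q hA hΔ t) / t =
      ∫ t in c..1, f (axisPt₀ Q hA hΔ t) / t := by
    intro j
    rw [integral_period_shift hA hΔ f hc0.ne' j]
    refine intervalIntegral.integral_congr fun t ht => ?_
    have ht0 : 0 < t := pos_of_mem_uIcc hc0 one_pos ht
    rw [← hck j, apply_axisPt₀_mul_of_invariant hA hΔ a hf j ht0]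
  simp_rw [hterm]
  rw [Finset.sum_const, Finset.card_range, nsmul_eq_mul]

end RootForms

end Literature.NumberTheory.Sieve
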